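import Summits.NavierStokesRegularity.FluidComputer.GateBudgetClockDebt
import Summits.NavierStokesRegularity.FluidComputer.GateBudgetMemberClock
import HarnessLib

/-!
# What no tuning can beat, part 33: NO SECOND PULSE BEFORE `√2 + 1.38` — every member's trigger
# stays at residue level, and every dud stays a dud, for `1.38` time units after dousing

Cell `pub-fluidc`, blueprint seat bp1 (gen 32, third item); same namespace and conventions as
parts 1–32 (`GateBudget*.lean`); imports part 31 (`GateBudgetClockDebt`: the clock's debt —
`knob_debt_trigger`, `knob_debt_cap_of_pin`) and part 32 (`GateBudgetMemberClock`: the state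
of every member at `M = K¹⁰` with its clock level `b(T) ≤ -0.69ε`,
`knob_member_state_headline_clock`). Modes `0 = a`, `1 = b` clock, `2 = c` trigger/catalyst,
`3 = d` transfer, `4 = ã` output; `w = ε/(K¹⁰ρ²)`, `t₋ = √(2 - 24 log K/K¹⁰)`,
`t₊ = √(2 + 2/K¹⁰) + 242/K⁹` (`t₋ ≤ s₀ < T ≤ t₊` for every member, part 28).
HONEST FRAMING (verbatim): low prior, high value-of-information experiment on Tao's machine
paradigm; NOT a claim that NS blows up.

THE POINT (SPEC (3): second-pulse exclusion past the self-timed `1/8`). Parts 29/30 certify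
the duds of the window only until `t₋ + 1/8 ≈ √2 + 1/8`, the end of the self-timed window of
the level `b(T) ≤ -ε/4`. With part 32's level `β = 0.69ε` and part 31's debt law, at
`M = K¹⁰`, `K ≥ 16`, `ε² ≤ 1/(6K²⁰)`, for EVERY member `200ε/K²⁰ ≤ ρ² ≤ 2ε/K¹⁰`:
§94 — the numerics: seed factor `e^{K¹⁰(0.69²/2 - 1)} = e^{-0.76195K¹⁰} ≤ 4/K²⁰`
(`x²/2 ≤ eˣ`) and dose `1.38λ₀ + e^{-0.76195K¹⁰}·1.38²/2 ≤ 2/K¹⁰`; §95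
(`knob_window_no_second_pulse`) — `c(t) ≤ 2ρ²/K¹⁰ (≤ 4ε/K²⁰)` for every
`t ∈ [t₊, t₋ + 69/50]`: after its pulse (height of order `ε`) the trigger of EVERY member sits
at residue level — NO SECOND PULSE anywhere in the window before `√2 + 1.38` (up to
`O(log K/K¹⁰)`); §96 (`knob_member_cap_debt`) — behind the pin
`L' = 0.99755|cos wπ| - 0.07|sin wπ| - 10⁻³ ≥ 0` of part 28: `ã(t)² ≤ 1 - L'² + 2/K¹⁰` for
every `t ∈ [0, t₋ + 69/50]` (part 30's §88 had `t₋ + 1/8` and `+ 10⁻³`); §97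
(`knob_dud_silent`) — ON the lattice `ε = kK¹⁰ρ²`: `ã(t)² ≤ 1/100` for every
`t ∈ [0, t₋ + 69/50]` (part 29's §85 had `t₋ + 1/8`). So the comb read at any instant of
`[√2 + 1/K, √2 + 1.38]` shows the same teeth (monotone, part 29) and the same duds: the duty
cycle of part 30 is STATIONARY for `1.25` time units after the instant, eleven self-timed
windows.

HONEST LIMITS. (i) The horizon `t₋ + 1.38` is where the certificate ends, not where a second
pulse begins: part 31's law is one-sided, and `0.69ε` under-estimates `|b(T)| ≈ b(s₀) ≈ √2ε`;
the true second critical time should be near `T + 2|b(T)|/ε ≈ 3√2`, beyond reach of the typed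
levels (part 32, HONEST LIMIT (ii)). Nothing here says a second pulse DOES occur. (ii) The caps
are as weak as the pins: near `|cos wπ| = |sin wπ|` §96 says little; the `2/K¹⁰` replaces
part 30's afterglow `10⁻³` but the pin's own `10⁻³` drift and `ψ = 0.07` remain. (iii) `M = K¹⁰`,
`K ≥ 16`, window `w ∈ [1/2, K¹⁰/200]` only. (iv) Bolt-on: parts 31/32 are consumed once
per theorem. (v) Nothing about Navier–Stokes.
[cite: Tao2016AveragedNS, §5.5 Theorem 5.3, (5.5), (5.6), (b-eq), (c-eq), (tcable)]
-/

noncomputable section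

namespace Summit.NavierStokesRegularity.FluidComputer.GateBudget

open Real Set Filter Topology
open Literature.Analysis.FluidPDE.Tao2016AveragedNS

/-! ## §94 The numerics of the debt at `M = K¹⁰`, `β = 0.69ε` -/

/-- The seed factor of part 31 at `M = K¹⁰`, `β = (69/100)ε`:
`e^{K¹⁰(69/100)²/2 - K¹⁰} = e^{-(15239/20000)K¹⁰} ≤ 4/K²⁰` (`K ≥ 16`; `x²/2 ≤ eˣ`).
[cite: Tao2016AveragedNS, §5.5 (5.5)] -/
theorem debt_seed_headline {K ε : ℝ} (hK : 16 ≤ K) (hε : 0 < ε) :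
    exp (K ^ 10 * (69 / 100 * ε) ^ 2 / (2 * ε ^ 2) - K ^ 10) ≤ 4 / K ^ 20 := by
  have hK0 : 0 < K := by linarith
  have hy : K ^ 10 * (69 / 100 * ε) ^ 2 / (2 * ε ^ 2) - K ^ 10 = -(15239 / 20000 * K ^ 10) := by
    rw [sub_eq_iff_eq_add, div_eq_iff (by positivity)]
    ring
  have h := Real.pow_div_factorial_le_exp (15239 / 20000 * K ^ 10) (by positivity) 2
  norm_num [Nat.factorial] at h
  rw [hy, Real.exp_neg, inv_eq_one_div, div_le_div_iff₀ (exp_pos _) (by positivity)]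
  nlinarith [h]

/-- The dose of part 31's `knob_debt_cap_of_pin` at `M = K¹⁰`, `β = (69/100)ε`,
`λ₀ = K⁻¹⁰ + 4e^{-K¹⁰}/K¹⁰` (`K ≥ 16`): `(69/50)λ₀ + e^{-(15239/20000)K¹⁰}(69/50)²/2 ≤ 2/K¹⁰`.
[cite: Tao2016AveragedNS, §5.5 (5.5)] -/
theorem debt_dose_headline {K ε : ℝ} (hK : 16 ≤ K) (hε : 0 < ε) :
    2 * (69 / 100 * ε) / ε * (1 / K ^ 10 + 4 * exp (-K ^ 10) / K ^ 10)
      + exp (K ^ 10 * (69 / 100 * ε) ^ 2 / (2 * ε ^ 2) - K ^ 10)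
        * (2 * (69 / 100 * ε) / ε) ^ 2 / 2 ≤ 2 / K ^ 10 := by
  have hK0 : 0 < K := by linarith
  have hK10 : 0 < K ^ 10 := by positivity
  have h10 : (1099511627776 : ℝ) ≤ K ^ 10 := by
    have := headline_pow_floor hK 10; norm_num at this; exact this
  have hW : 2 * (69 / 100 * ε) / ε = 69 / 50 := by
    rw [div_eq_iff hε.ne']; ring
  rw [hW, show (2 : ℝ) / K ^ 10 = 2 * (1 / K ^ 10) by ring]
  have hE := debt_seed_headline hK hε
  have he := headline_exp_le hK
  have h1 : 4 * exp (-K ^ 10) / K ^ 10 ≤ 4 * (1 / K ^ 10) / K ^ 10 :=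
    div_le_div_of_nonneg_right (mul_le_mul_of_nonneg_left he (by norm_num)) hK10.le
  have hq : 4 * (1 / K ^ 10) / K ^ 10 = 4 * (1 / K ^ 10 * (1 / K ^ 10)) := by ring
  have hv : (4 : ℝ) / K ^ 20 = 4 * (1 / K ^ 10 * (1 / K ^ 10)) := by ring
  have hu0 : (0 : ℝ) ≤ 1 / K ^ 10 := by positivity
  have hl1 : (1 : ℝ) / K ^ 10 ≤ 1 / 1099511627776 :=
    div_le_div_of_nonneg_left (by norm_num) (by norm_num) h10
  have hu2 : 1 / K ^ 10 * (1 / K ^ 10) ≤ 1 / 1099511627776 * (1 / K ^ 10) :=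
    mul_le_mul_of_nonneg_right hl1 hu0
  linarith [h1, hq, hv, hu2, hE, hu0]

variable {K ε ρ : ℝ} {X : ℝ → Fin 5 → ℝ} {C : ℝ → ℝ}

/-! ## §95 No second pulse in the window before `√2 + 1.38` -/

/-- **NO MEMBER OF THE WINDOW FIRES TWICE BEFORE `√2 + 1.38`.** For `K ≥ 16`, `0 < ε`,
`ε² ≤ 1/(6K²⁰)` and an exact trajectory of `rotorCircuit K K¹⁰ ε ρ` from (5.6) with
`200ε/K²⁰ ≤ ρ² ≤ 2ε/K¹⁰` (ANY member, no lattice condition): `c(t) ≤ 2ρ²/K¹⁰` for EVERY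
`t ∈ [√(2 + 2/K¹⁰) + 242/K⁹, √(2 - 24 log K/K¹⁰) + 69/50]` — part 32's state
(`T ≤ √(2 + 2/K¹⁰) + 242/K⁹`, `√(2 - 24 log K/K¹⁰) ≤ s₀ < T`, `b(T) ≤ -0.69ε`,
`c(T) ≤ (K⁻¹⁰ + 4e^{-K¹⁰}/K¹⁰)ρ²`) and part 31's `knob_debt_trigger` on `[T, T + 69/50]` with
§94's seed factor. The pulse itself has height of order `ε ≥ K¹⁰ρ²/2`; here the trigger is
within twice its ENTRY level `ρ²/K¹⁰`.
[cite: Tao2016AveragedNS, §5.5 Theorem 5.3, (5.5), (5.6), (b-eq), (c-eq), (tcable)] -/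
theorem knob_window_no_second_pulse
    (hX : ∀ t, HasDerivAt X (RotorKnob.rotorCircuit K (K ^ 10) ε ρ (X t)) t)
    (h0 : X 0 = delayInit) (hC : ∀ t, HasDerivAt C (X t 2) t) (hK : 16 ≤ K) (hε : 0 < ε)
    (hεK : ε ^ 2 ≤ 1 / (6 * K ^ 20)) (hρ : 0 < ρ) (hlo : 200 * ε / K ^ 20 ≤ ρ ^ 2)
    (hhi : K ^ 10 * ρ ^ 2 ≤ 2 * ε) :
    ∀ t ∈ Icc (√(2 + 2 / K ^ 10) + 242 / K ^ 9) (√(2 - 24 * Real.log K / K ^ 10) + 69 / 50),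
      X t 2 ≤ 2 * ρ ^ 2 / K ^ 10 := by
  have hK0 : 0 < K := by linarith
  have hK10 : 0 < K ^ 10 := by positivity
  have h10 : (1099511627776 : ℝ) ≤ K ^ 10 := by
    have := headline_pow_floor hK 10; norm_num at this; exact this
  obtain ⟨s₀, T, hsq1, hsq2, hs1, -, hsT, hTs, -, hcT, -, -, -, -, -, hb69⟩ :=
    knob_member_state_headline_clock hX h0 hC hK hε hεK hρ hlo hhi
  have hs0 : 0 ≤ s₀ := by linarith
  have hT0 : 0 ≤ T := by linarith
  have hlow : √(2 - 24 * Real.log K / K ^ 10) ≤ s₀ := (Real.sqrt_le_left hs0).2 hsq1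
  have hup : s₀ ≤ √(2 + 2 / K ^ 10) := Real.le_sqrt_of_sq_le hsq2
  have hW : T + 2 * (69 / 100 * ε) / ε = T + 69 / 50 := by
    congr 1; rw [div_eq_iff hε.ne']; ring
  have hE := debt_seed_headline hK hε
  have he := headline_exp_le hK
  -- the residue and the seed term together stay below `2ρ²/K¹⁰`
  have hsmall : 4 * exp (-K ^ 10) / K ^ 10 + 4 / K ^ 20 * (69 / 50) ≤ 1 / K ^ 10 := by
    have h1 : 4 * exp (-K ^ 10) / K ^ 10 ≤ 4 * (1 / K ^ 10) / K ^ 10 :=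
      div_le_div_of_nonneg_right (mul_le_mul_of_nonneg_left he (by norm_num)) hK10.le
    have hq : 4 * (1 / K ^ 10) / K ^ 10 = 4 * (1 / K ^ 10 * (1 / K ^ 10)) := by ring
    have hv : (4 : ℝ) / K ^ 20 = 4 * (1 / K ^ 10 * (1 / K ^ 10)) := by ring
    have hu0 : (0 : ℝ) ≤ 1 / K ^ 10 := by positivity
    have hl1 : (1 : ℝ) / K ^ 10 ≤ 1 / 1099511627776 :=
      div_le_div_of_nonneg_left (by norm_num) (by norm_num) h10
    have hu2 : 1 / K ^ 10 * (1 / K ^ 10) ≤ 1 / 1099511627776 * (1 / K ^ 10) :=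
      mul_le_mul_of_nonneg_right hl1 hu0
    linarith [h1, hq, hv, hu2, hu0]
  have hnum := mul_le_mul_of_nonneg_right hsmall (sq_nonneg ρ)
  intro t ht
  have ht' : t ∈ Icc T (T + 2 * (69 / 100 * ε) / ε) := by
    rw [hW]; constructor <;> linarith [ht.1, ht.2]
  have h := knob_debt_trigger hX h0 hε hρ hK10.le hT0 hb69 ht'
  have htT : t - T ≤ 69 / 50 := by linarith [ht.2]
  have hEt : ρ ^ 2 * exp (K ^ 10 * (69 / 100 * ε) ^ 2 / (2 * ε ^ 2) - K ^ 10) * (t - T)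
      ≤ ρ ^ 2 * (4 / K ^ 20) * (69 / 50) :=
    mul_le_mul (mul_le_mul_of_nonneg_left hE (sq_nonneg ρ)) htT (by linarith [ht'.1])
      (by positivity)
  rw [show 2 * ρ ^ 2 / K ^ 10 = 2 * (1 / K ^ 10) * ρ ^ 2 by ring]
  linarith [hcT, hEt, hnum]

/-! ## §96 The cap of any member until `√2 + 1.38` -/

/-- **THE CAP OF ANY MEMBER BEHIND ITS PIN HOLDS UNTIL `√2 + 1.38`.** Same hypotheses (any
member, `w = ε/(K¹⁰ρ²)`, `c = |cos wπ|`, `s = |sin wπ|`): if the pin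
`L' = 0.99755c - 0.07s - 10⁻³` is `≥ 0` then `ã(t)² ≤ 1 - L'² + 2/K¹⁰` for EVERY
`t ∈ [0, √(2 - 24 log K/K¹⁰) + 69/50]` — part 31's `knob_debt_cap_of_pin` on the debt window
`[0, T + 69/50]` of part 32's level `b(T) ≤ -0.69ε`, behind part 28's pin `L' ≤ |a(T)|`,
with §94's dose; `√(2 - 24 log K/K¹⁰) ≤ s₀ < T`. Part 30's §88 stopped at `+ 1/8`.
[cite: Tao2016AveragedNS, §5.5 Theorem 5.3, (5.5), (5.6), (energy-con), (tcable)] -/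
theorem knob_member_cap_debt
    (hX : ∀ t, HasDerivAt X (RotorKnob.rotorCircuit K (K ^ 10) ε ρ (X t)) t)
    (h0 : X 0 = delayInit) (hC : ∀ t, HasDerivAt C (X t 2) t) (hK : 16 ≤ K) (hε : 0 < ε)
    (hεK : ε ^ 2 ≤ 1 / (6 * K ^ 20)) (hρ : 0 < ρ) (hlo : 200 * ε / K ^ 20 ≤ ρ ^ 2)
    (hhi : K ^ 10 * ρ ^ 2 ≤ 2 * ε)
    (hL : 0 ≤ 19951 / 20000 * |cos (ε / (K ^ 10 * ρ ^ 2) * π)|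
        - 7 / 100 * |sin (ε / (K ^ 10 * ρ ^ 2) * π)| - 1 / 1000) :
    ∀ t ∈ Icc 0 (√(2 - 24 * Real.log K / K ^ 10) + 69 / 50),
      X t 4 ^ 2 ≤ 1 - (19951 / 20000 * |cos (ε / (K ^ 10 * ρ ^ 2) * π)|
        - 7 / 100 * |sin (ε / (K ^ 10 * ρ ^ 2) * π)| - 1 / 1000) ^ 2 + 2 / K ^ 10 := by
  have hK0 : 0 < K := by linarith
  have hK10 : 0 < K ^ 10 := by positivity
  obtain ⟨s₀, T, hsq1, -, hs1, -, hsT, -, -, hcT, -, -, -, ha2, -, hb69⟩ :=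
    knob_member_state_headline_clock hX h0 hC hK hε hεK hρ hlo hhi
  have hs0 : 0 ≤ s₀ := by linarith
  have hT0 : 0 ≤ T := by linarith
  have hlow : √(2 - 24 * Real.log K / K ^ 10) ≤ s₀ := (Real.sqrt_le_left hs0).2 hsq1
  have hW : T + 2 * (69 / 100 * ε) / ε = T + 69 / 50 := by
    congr 1; rw [div_eq_iff hε.ne']; ring
  have hdose := debt_dose_headline hK hε
  intro t ht
  have ht' : t ∈ Icc 0 (T + 2 * (69 / 100 * ε) / ε) := by
    rw [hW]; exact ⟨ht.1, by linarith [ht.2]⟩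
  have hcap := knob_debt_cap_of_pin hX h0 hε hρ hK10.le hK0.le
    (lam₀ := 1 / K ^ 10 + 4 * exp (-K ^ 10) / K ^ 10) hT0 (by positivity) hb69 hcT hL ha2 ht'
  linarith

/-! ## §97 The duds stay duds until `√2 + 1.38` -/

/-- **THE DUDS OF THE LATTICE STAY SILENT UNTIL `√2 + 1.38`.** Same hypotheses ON the lattice
`ε = kK¹⁰ρ²` (`k ∈ ℕ`): `ã(t)² ≤ 1/100` for EVERY `t ∈ [0, √(2 - 24 log K/K¹⁰) + 69/50]` —
§96 at `sin kπ = 0`, `|cos kπ| = 1` (pin `19931/20000`, `1 - 0.99655² + 2/K¹⁰ ≤ 1/100`).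
Part 29's `knob_dud_holds` stopped at `√(2 - 24 log K/K¹⁰) + 1/8`: the second-pulse exclusion
of SPEC (3) now runs `1.38` time units past dousing, for every dud of the window at once.
[cite: Tao2016AveragedNS, §5.5 Theorem 5.3, (5.5), (5.6), (energy-con), (tcable)] -/
theorem knob_dud_silent
    (hX : ∀ t, HasDerivAt X (RotorKnob.rotorCircuit K (K ^ 10) ε ρ (X t)) t)
    (h0 : X 0 = delayInit) (hC : ∀ t, HasDerivAt C (X t 2) t) (hK : 16 ≤ K) (hε : 0 < ε)
    (hεK : ε ^ 2 ≤ 1 / (6 * K ^ 20)) (hρ : 0 < ρ) (hlo : 200 * ε / K ^ 20 ≤ ρ ^ 2)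
    (hhi : K ^ 10 * ρ ^ 2 ≤ 2 * ε) (k : ℕ) (hk : ε = k * K ^ 10 * ρ ^ 2) :
    ∀ t ∈ Icc 0 (√(2 - 24 * Real.log K / K ^ 10) + 69 / 50), X t 4 ^ 2 ≤ 1 / 100 := by
  have hK0 : 0 < K := by linarith
  have hK10 : 0 < K ^ 10 := by positivity
  have h10 : (1099511627776 : ℝ) ≤ K ^ 10 := by
    have := headline_pow_floor hK 10; norm_num at this; exact this
  -- on the lattice `w = k`: `sin kπ = 0`, `|cos kπ| = 1`
  have hw : ε / (K ^ 10 * ρ ^ 2) = k := by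
    rw [div_eq_iff (by positivity), hk]; ring
  have hs : |sin (ε / (K ^ 10 * ρ ^ 2) * π)| = 0 := by
    rw [hw, Real.sin_nat_mul_pi, abs_zero]
  have hc : |cos (ε / (K ^ 10 * ρ ^ 2) * π)| = 1 := by
    rw [hw]; exact_mod_cast Real.abs_cos_int_mul_pi k
  have hcap := knob_member_cap_debt hX h0 hC hK hε hεK hρ hlo hhi (by rw [hs, hc]; norm_num)
  rw [hs, hc] at hcap
  have h2 : (2 : ℝ) / K ^ 10 ≤ 2 / 1099511627776 :=
    div_le_div_of_nonneg_left (by norm_num) (by norm_num) h10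
  have hn : (1 : ℝ) - (19951 / 20000 * 1 - 7 / 100 * 0 - 1 / 1000) ^ 2 + 2 / 1099511627776
      ≤ 1 / 100 := by norm_num
  intro t ht
  linarith [hcap t ht]

end Summit.NavierStokesRegularity.FluidComputer.GateBudget
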